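import Summits.QuantumFields.YangMills.Theorems.FluctuationComparisonRegPrIntLHeightwiseQuotientOfPackageV4Chi
import Summits.QuantumFields.YangMills.Theorems.FluctuationComparisonRegPrIntLPersistenceOfPackageV3
import HarnessLib

/-!
# LOWB∘, PERS₁∘ AND TUBE∘ (TEXTS VERBATIM) FROM THE 19936 REGISTRY's TWO ROWS {EX = `hT8`, (O‴χₛ) = `hrows`} BY NAME — the χ∕rows EDITION OF RECORD of the persistence leaf
# (★★OWNER RULING №44 (iii)), with the window question of the χ road settled by the PINNED [Balaban1985Variational] constant `B₃ = B` of `hrows`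

Cell `ym3-torus` (YM ladder rung R3 = continuum `SU(2)` Yang–Mills on the three-torus — a RUNG, NOT d = 4, NOT infinite volume, NOT a mass gap, NOT Clay).  Width seat
`ym-ust-20520-w3` (gen 19, LEAD-20520 by lineage); `--supports stmt-QuantumFields-20520 --as helper`, count-neutral, definition-free, default heartbeats.

THE POINT.  On the χ road the lower letter (47)′ lives on the INTERIOR window `{PlaqSmall θBal(𝔠.b₀, 𝔠.p₀, n)∕max 𝔠.B₃ 1}` (✓`…HeightwiseQuotientOfPackageV4Chi` §1∕§3), so LOWB∘'s EXACT
window at profile `(b₀, p₀)` needs the record at the SCALED profile `(max B₃ 1·b₀, p₀)` — possible only if `B₃` is known BEFORE the profile.  Through the socket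
`AlphaInputsT3ACv4RecChi L` it is not (each profile's record carries its own `B₃`); but in the 19936 rows it IS: `hrows` reads `∀ B … ∃ b₁ p₁ ∀ b₀ p₀ … ∃ 𝔠, 𝔠.b₀ = b₀ ∧ 𝔠.p₀ = p₀ ∧
𝔠.B₃ = B ∧ …` — print's «B₃ = B₃(d, L)».  §1 extracts this B-UNIFORM socket from `(hT8, hrows)` (the proof of ✓`HistoryTailSelSupplier.pinnedPartsT3ACRecSelXsV4Chi_of_thm1_rows` kept one
step longer: `B := max (max B₃ B₀) ½`, the window `(a₀, a₁)` by ✓`HistoryTailOneSupplier.exists_small_window`, [7] Thm 1 transported by ✓`MinimiserPin.thm1GlobalMinAt_anti∕_mono`, the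
package by ✓`AlphaInputsT3AC.ofV4ChiAt_of_pinnedPartsSelXsChi_cast`); §2 runs ✓`quotientBounds_of_packageV4Chi` at the scaled profile, where the interior window IS print's window at
`(b₀, p₀)` (w5-20520 g18 ✓`plaqSmall_interior_of_profile_mul_iff`); §3 feeds LEAD g18 ✓p766163 and w4 ✓p766221 through the profile-monotonicity bundle of ✓p768520 (re-derived here
from UP∘ ∧ LOWB∘ as data, `upLow_of_stabilityCans`).
* §1 ★★★ `uniformRecChi_of_thm1In8_selXsDataRows (hT8) (hrows)` — `∀ L, Odd L → 1 < L → ∃ B a₀ a₁ b₁ p₁, 0 < B ∧ 0 < a₀ ∧ 0 < a₁ ∧ B·a₁ ≤ a₀ ∧ ∀ b₀ ≥ b₁, ∀ p₀ ≥ p₁, ∃ 𝔠, 𝔠.b₀ = b₀ ∧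
  𝔠.p₀ = p₀ ∧ 𝔠.B₃ = B ∧ ∀ F (hF : F.L = L), OfV4ChiAt F (hF ▸ 𝔠) a₀ a₁`.
* §2 ★★★★★ `stabilityCans_of_thm1In8_selXsDataRows (hT8) (hrows) : ⟨UP∘⟩ ∧ ⟨LOWB∘⟩` — BOTH ORGAN ROWS, TEXTS VERBATIM (`StabilityUpperCan` :224 ∕ `StabilityLowerWindowCan` :229 of
  `Lines/history_split.lean`), FROM THE 19936 ROWS BY NAME.
* §3 ★★★★ `upLow_of_stabilityCans` (the consumers' bundle from UP∘ ∧ LOWB∘ as hypotheses — ✓p768520's `upLow_of_v3Rec` with the socket abstracted); ★★★★★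
  `oneLevelPersistenceIntCan_of_thm1In8_selXsDataRows (hT8) (hrows) : ⟨PERS₁∘⟩`; ★★★★★ `sectionTubeMassIntCan_of_thm1In8_selXsDataRows (hT8) (hrows) : ⟨TUBE∘⟩`.

NET.  THE WHOLE PERSISTENCE LEAF {UP∘, LOWB∘, PERS₁∘, TUBE∘} IS CONDITIONAL ON THE 19936 REGISTRY v6 ROWS {`stub_existenceMinimalOrbit` = EX (via `hT8`'s [7] Thm 1 ∧ (8) socket),
`stub_selXsV4DataRows` = (O‴χₛ) (`hrows`)} — the two binders the R3 certificate ✓p758552 already displays; no Thm-1 row, no large-field row, no main-term row, no counterterm row,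
no socket letter beyond them.  (`hT8`'s text is the `stub_thm1In8GlobalMin` letter of the superseded χ-lines; its relation to the registered EX row is the EX lane's, not claimed here.)

HONEST SCOPE.  Knits over landed theorems; CONDITIONAL on {`hT8`, `hrows`} (OPEN: [Balaban1985Variational] Thm 1 + (8) for the pinned `ℰp`, and NODE O's d = 3 χ-data rows);
nothing of Theorem 1, of the persistence organ's parents LFR♯ᶜ∘∕S2β, of `FluctuationComparisonRegPrIntL` (20520), of EX (19200) or `HistoryTailL` (19936) is proved; registry 20520
v11.4 0∕5 UNCHANGED; no summit is proved by a helper; rung R3 = SU(2) YM₃ on T³ — NOT d = 4, NOT infinite volume, NOT a mass gap, NOT Clay.  Sorry-free, axioms standard.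

References: T. Bałaban, CMP **102** (1985) 255–275 [Balaban1985UV3] ((4)–(7) pp.256–257, Thm 1 p.257, (41) p.266, (46)–(47) p.267, (67)–(71) p.273, Thm 2 p.272); T. Bałaban,
CMP **102** (1985) 277–309 [Balaban1985Variational] (Thm 1 (8) p.279); T. Bałaban, CMP **98** (1985) 17–51 [Balaban1985Averaging] ((10) p.19).
-/

set_option autoImplicit false

noncomputable section

namespace Summit.QuantumFields.YangMills.Theorems.FluctuationComparisonRegPrIntLPersistenceOfRowsV4Chi

open MeasureTheory
open Literature.MathematicalPhysics.QuantumFieldTheory.Balaban1983to89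
open Literature.MathematicalPhysics.QuantumFieldTheory.Balaban1983to89.T3ContinuumYM3Torus
open Literature.MathematicalPhysics.QuantumFieldTheory.Balaban1983to89.T3UnitLawDensityEML (ℰp)
open Literature.MathematicalPhysics.QuantumFieldTheory.Balaban1983to89.T3UnitScaleTilt (θBal gibbsK)
open Literature.MathematicalPhysics.QuantumFieldTheory.Balaban1983to89.T3TiltDescent (heightDensity descendTo)
open Literature.MathematicalPhysics.QuantumFieldTheory.Balaban1983to89.T3HeightwiseDensityBounds
open Literature.MathematicalPhysics.QuantumFieldTheory.Balaban1983to89.T3PrintedMinimiserExistence (Thm1GlobalMinAt)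
open Literature.MathematicalPhysics.QuantumFieldTheory.Balaban1983to89.T3LowerAlongMinimisersSplit (MinimisersIn8At)
open Literature.MathematicalPhysics.QuantumFieldTheory.Balaban1983to89.ExpMeanLog (deltaSU)
open Literature.MathematicalPhysics.QuantumFieldTheory.Balaban1983to89.Missing (partitionFn)
open Literature.MathematicalPhysics.QuantumFieldTheory.Balaban1983to89.B7Prop2Explicit (C0)
open Literature.MathematicalPhysics.QuantumFieldTheory.Balaban1985CMP102
open Literature.MathematicalPhysics.QuantumFieldTheory.Balaban1985CMP102.Setting
open Summit.QuantumFields.Balaban3D.Carriers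
open Summit.QuantumFields.Balaban3D.Proofs.Primitives
open Summit.QuantumFields.Balaban3D.Proofs.Thresholds (Q0)
open Summit.QuantumFields.YangMills.Theorems.FluctuationComparisonRegPrIntLHeightwiseQuotientOfPackageV4Chi (quotientBounds_of_packageV4Chi)
open Summit.QuantumFields.YangMills.Theorems.FluctuationComparisonRegPrIntLHeightwiseQuotientAnchoringChi (plaqSmall_interior_of_profile_mul_iff)
open Summit.QuantumFields.YangMills.Theorems.FluctuationComparisonRegPrIntLHeightwiseMainTermRows (exists_coupling_window_letters)

/-! ## §1 The B-uniform v4 χ-socket from the 19936 rows -/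

/-- ★★★ **THE B-UNIFORM v4 χ-SOCKET FROM THE 19936 REGISTRY v6 ROWS BY NAME**: for every odd `L > 1`, ONE [7]-constant `B > 0` and ONE window `(a₀, a₁)` (`B·a₁ ≤ a₀`) and profile
thresholds `(b₁, p₁)` such that EVERY profile beyond them has a record `𝔠` with `𝔠.b₀ = b₀`, `𝔠.p₀ = p₀`, `𝔠.B₃ = B` and the v4 χ-package `OfV4ChiAt F (hF ▸ 𝔠) a₀ a₁` at every
three-torus family of block size `L` — the proof of ✓`HistoryTailSelSupplier.pinnedPartsT3ACRecSelXsV4Chi_of_thm1_rows` with the uniformity of `B, a₀, a₁` KEPT in the statement.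
[cite: Balaban1985UV3, Thm 2 p.272 + (47) p.267 + (67)–(71) p.273; Balaban1985Variational, Thm 1 (8) p.279] -/
theorem uniformRecChi_of_thm1In8_selXsDataRows
    (hT8 : ∀ L : ℕ, Odd L → 1 < L → ∃ a₀ a₁ B₃ : ℝ, 0 < a₀ ∧ 0 < a₁ ∧ 0 < B₃ ∧
      Thm1GlobalMinAt L a₀ a₁ B₃ ∧ MinimisersIn8At L a₀ a₁ B₃)
    (hrows : ∀ L : ℕ, Odd L → 1 < L → ∃ (B₀ A₀ A₁ : ℝ), 0 < A₀ ∧ 0 < A₁ ∧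
      ∀ (B a₀ a₁ : ℝ), B₀ ≤ B → 1 ≤ 2 * B → 0 < a₀ → a₀ ≤ A₀ → 0 < a₁ → a₁ ≤ A₁ → B * a₁ ≤ a₀ →
        (143 * ((((3 + 4 : ℕ) : ℝ)) ^ 2 / 4) ^ 2) * (2 * (B * a₁)) ≤ 1 / 3 →
        2 * (2 * (B * a₁)) ≤ 2 * deltaSU (Fin 2) / (((3 + 4) * L : ℕ) : ℝ) ^ 2 →
        Thm1GlobalMinAt L a₀ a₁ B →
        ∃ (b₁ p₁ : ℝ), ∀ (b₀ p₀ : ℝ), b₁ ≤ b₀ → p₁ ≤ p₀ →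
          ∃ 𝔠 : AlphaConsts L (suGroupModel 2).N, 𝔠.b₀ = b₀ ∧ 𝔠.p₀ = p₀ ∧ 𝔠.B₃ = B ∧
            4 * 𝔠.B₃ * (L : ℝ) ^ 2 * avgWindowFactor L ≤ 𝔠.C68 ∧
            Real.exp (𝔠.p₀ - 1) ≤ 3 * C0 3 * 𝔠.C68 * (𝔠.b₀ * Q0 𝔠.p₀) ∧
            (𝔠.b₀ * Q0 𝔠.p₀) * (2 * (L : ℝ) ^ 2 * avgWindowFactor L) ^ 2 ≤ 3 * C0 3 * 𝔠.C68 * a₁ ^ 2 ∧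
            ∀ (F : T3Family) (hF : F.L = L),
              (∀ (γ : ℝ) (hγ : 0 < γ) (hγ1 : γ ≤ (min (hF ▸ 𝔠).gamma0 1) ^ 2) (K : ℕ),
                AlphaInputsT3AC.SmallFactor71OfRecT3 F (hF ▸ 𝔠) γ hγ hγ1 K) ∧
              ∀ (γ : ℝ) (hγ : 0 < γ) (hγ1 : γ ≤ (min (hF ▸ 𝔠).gamma0 1) ^ 2) (K : ℕ),
                (∃ Ut : (k : ℕ) → GaugeField (F.P K) k (Matrix.specialUnitaryGroup (Fin 2) ℂ) →
                    GaugeField (F.P K) 0 (Matrix.specialUnitaryGroup (Fin 2) ℂ),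
                  AlphaInputsT3AC.TrivMinimiserRowsT3 F (hF ▸ 𝔠) γ hγ hγ1 a₀ a₁ K Ut) →
                ∃ Ut : (k : ℕ) → GaugeField (F.P K) k (Matrix.specialUnitaryGroup (Fin 2) ℂ) →
                    GaugeField (F.P K) 0 (Matrix.specialUnitaryGroup (Fin 2) ℂ),
                  AlphaInputsT3AC.TrivMinimiserRowsT3 F (hF ▸ 𝔠) γ hγ hγ1 a₀ a₁ K Ut ∧
                    AlphaInputsT3AC.DataRowsT3XsChiSel F (hF ▸ 𝔠) γ hγ hγ1 K Ut) :
    ∀ L : ℕ, Odd L → 1 < L → ∃ (B a₀ a₁ b₁ p₁ : ℝ), 0 < B ∧ 0 < a₀ ∧ 0 < a₁ ∧ B * a₁ ≤ a₀ ∧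
      ∀ (b₀ p₀ : ℝ), b₁ ≤ b₀ → p₁ ≤ p₀ →
        ∃ 𝔠 : AlphaConsts L (suGroupModel 2).N, 𝔠.b₀ = b₀ ∧ 𝔠.p₀ = p₀ ∧ 𝔠.B₃ = B ∧
          ∀ (F : T3Family) (hF : F.L = L), AlphaInputsT3AC.OfV4ChiAt F (hF ▸ 𝔠) a₀ a₁ := by
  intro L hLo hL
  obtain ⟨aT₀, aT₁, BT, haT₀, haT₁, hBT, hT, -⟩ := hT8 L hLo hL
  obtain ⟨B₀, A₀, A₁, hA₀, hA₁, h⟩ := hrows L hLo hL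
  set B : ℝ := max (max BT B₀) (1 / 2) with hB_def
  have hBT_le : BT ≤ B := (le_max_left _ _).trans (le_max_left _ _)
  have hB₀_le : B₀ ≤ B := (le_max_right _ _).trans (le_max_left _ _)
  have hBhalf : 1 / 2 ≤ B := le_max_right _ _
  have hBpos : 0 < B := lt_of_lt_of_le (by norm_num) hBhalf
  have h2B : 1 ≤ 2 * B := by linarith
  obtain ⟨a₀, a₁, ha₀, ha₀A, ha₁, ha₁A, hwin, hA3, hA2⟩ :=
    HistoryTailOneSupplier.exists_small_window hL hBpos (lt_min hA₀ haT₀) (lt_min hA₁ haT₁)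
  have hT' : Thm1GlobalMinAt L a₀ a₁ B :=
    MinimiserPin.thm1GlobalMinAt_mono
      (MinimiserPin.thm1GlobalMinAt_anti hT (ha₀A.trans (min_le_right _ _)) (ha₁A.trans (min_le_right _ _))) le_rfl hBT_le
  obtain ⟨b₁, p₁, hrec⟩ := h B a₀ a₁ hB₀_le h2B ha₀ (ha₀A.trans (min_le_left _ _)) ha₁ (ha₁A.trans (min_le_left _ _))
    hwin hA3 hA2 hT'
  refine ⟨B, a₀, a₁, b₁, p₁, hBpos, ha₀, ha₁, hwin, fun b₀ p₀ hb hp => ?_⟩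
  obtain ⟨𝔠, h1, h2, hB3, s1, s2, s3, hFO⟩ := hrec b₀ p₀ hb hp
  refine ⟨𝔠, h1, h2, hB3, fun F hF => ?_⟩
  exact AlphaInputsT3AC.ofV4ChiAt_of_pinnedPartsSelXsChi_cast ha₁ (by rw [hB3]; exact hwin) (by rw [hB3]; exact hA3)
    (by rw [hB3]; exact hA2) (by rw [hB3]; exact h2B) s1 s2 s3 (by rw [hB3]; exact hT') F hF (hFO F hF).1 (hFO F hF).2

/-! ## §2 UP∘ ∧ LOWB∘ — texts verbatim — from the 19936 rows -/

/-- ★★★★★ **THE ORGAN ROWS UP∘ ∧ LOWB∘ (`StabilityUpperCan` ∧ `StabilityLowerWindowCan` of `Lines/history_split.lean`, TEXTS VERBATIM) FROM THE 19936 REGISTRY v6 ROWS {EX = `hT8`,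
(O‴χₛ) = `hrows`} BY NAME.**  Per odd `L > 1`: the B-uniform socket of §1; thresholds `bB := max b₁ 0`, `pB := p₁`; for a profile `(b₀, p₀)` beyond them the record at the SCALED profile
`(max B 1·b₀, p₀)` (`≥ b₁` since `max B 1 ≥ 1`, `b₀ ≥ 0`), whose interior window `θBal(max B 1·b₀)∕max B 1 = θBal(b₀)` IS print's window at `(b₀, p₀)`
(✓`plaqSmall_interior_of_profile_mul_iff`); `γ₁ := min (min γ₀ 1)² γθ` (✓`exists_coupling_window_letters`); then ✓`quotientBounds_of_packageV4Chi`.  The `L` with no family are vacuous.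
[cite: Balaban1985UV3, Thm 1 (5)–(6) pp.256–257, (41) p.266, (46)–(47) p.267, pp.273–274; Balaban1985Variational, Thm 1 (8) p.279] -/
theorem stabilityCans_of_thm1In8_selXsDataRows
    (hT8 : ∀ L : ℕ, Odd L → 1 < L → ∃ a₀ a₁ B₃ : ℝ, 0 < a₀ ∧ 0 < a₁ ∧ 0 < B₃ ∧
      Thm1GlobalMinAt L a₀ a₁ B₃ ∧ MinimisersIn8At L a₀ a₁ B₃)
    (hrows : ∀ L : ℕ, Odd L → 1 < L → ∃ (B₀ A₀ A₁ : ℝ), 0 < A₀ ∧ 0 < A₁ ∧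
      ∀ (B a₀ a₁ : ℝ), B₀ ≤ B → 1 ≤ 2 * B → 0 < a₀ → a₀ ≤ A₀ → 0 < a₁ → a₁ ≤ A₁ → B * a₁ ≤ a₀ →
        (143 * ((((3 + 4 : ℕ) : ℝ)) ^ 2 / 4) ^ 2) * (2 * (B * a₁)) ≤ 1 / 3 →
        2 * (2 * (B * a₁)) ≤ 2 * deltaSU (Fin 2) / (((3 + 4) * L : ℕ) : ℝ) ^ 2 →
        Thm1GlobalMinAt L a₀ a₁ B →
        ∃ (b₁ p₁ : ℝ), ∀ (b₀ p₀ : ℝ), b₁ ≤ b₀ → p₁ ≤ p₀ →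
          ∃ 𝔠 : AlphaConsts L (suGroupModel 2).N, 𝔠.b₀ = b₀ ∧ 𝔠.p₀ = p₀ ∧ 𝔠.B₃ = B ∧
            4 * 𝔠.B₃ * (L : ℝ) ^ 2 * avgWindowFactor L ≤ 𝔠.C68 ∧
            Real.exp (𝔠.p₀ - 1) ≤ 3 * C0 3 * 𝔠.C68 * (𝔠.b₀ * Q0 𝔠.p₀) ∧
            (𝔠.b₀ * Q0 𝔠.p₀) * (2 * (L : ℝ) ^ 2 * avgWindowFactor L) ^ 2 ≤ 3 * C0 3 * 𝔠.C68 * a₁ ^ 2 ∧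
            ∀ (F : T3Family) (hF : F.L = L),
              (∀ (γ : ℝ) (hγ : 0 < γ) (hγ1 : γ ≤ (min (hF ▸ 𝔠).gamma0 1) ^ 2) (K : ℕ),
                AlphaInputsT3AC.SmallFactor71OfRecT3 F (hF ▸ 𝔠) γ hγ hγ1 K) ∧
              ∀ (γ : ℝ) (hγ : 0 < γ) (hγ1 : γ ≤ (min (hF ▸ 𝔠).gamma0 1) ^ 2) (K : ℕ),
                (∃ Ut : (k : ℕ) → GaugeField (F.P K) k (Matrix.specialUnitaryGroup (Fin 2) ℂ) →
                    GaugeField (F.P K) 0 (Matrix.specialUnitaryGroup (Fin 2) ℂ),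
                  AlphaInputsT3AC.TrivMinimiserRowsT3 F (hF ▸ 𝔠) γ hγ hγ1 a₀ a₁ K Ut) →
                ∃ Ut : (k : ℕ) → GaugeField (F.P K) k (Matrix.specialUnitaryGroup (Fin 2) ℂ) →
                    GaugeField (F.P K) 0 (Matrix.specialUnitaryGroup (Fin 2) ℂ),
                  AlphaInputsT3AC.TrivMinimiserRowsT3 F (hF ▸ 𝔠) γ hγ hγ1 a₀ a₁ K Ut ∧
                    AlphaInputsT3AC.DataRowsT3XsChiSel F (hF ▸ 𝔠) γ hγ hγ1 K Ut) :
    (∀ (L : ℕ), ∃ γ₁ : ℝ, 0 < γ₁ ∧ ∀ (F : T3Family) (γ : ℝ), F.L = L → 0 < γ → γ ≤ γ₁ → HeightwiseUpperBound F γ) ∧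
    (∀ (L : ℕ), ∃ bB pB : ℝ, ∀ (b₀ p₀ : ℝ), bB ≤ b₀ → pB ≤ p₀ →
      ∃ γ₁ : ℝ, 0 < γ₁ ∧ ∀ (F : T3Family) (γ : ℝ), F.L = L → 0 < γ → γ ≤ γ₁ →
        ∀ (n : ℕ), ∃ cl : ℝ, 0 < cl ∧ ∀ (K : ℕ) (hK : n ≤ K),
          ∀ᵐ V ∂(fieldMeasure (F.P n) 0 (Matrix.specialUnitaryGroup (Fin 2) ℂ)),
            PlaqSmall (θBal F.L γ b₀ p₀ n) V →
              cl ≤ (partitionFn (G := Matrix.specialUnitaryGroup (Fin 2) ℂ) (F.P K) ((F.scheme ℰp γ).β K))⁻¹ *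
                heightDensity F γ hK Set.univ V) := by
  have huni := uniformRecChi_of_thm1In8_selXsDataRows hT8 hrows
  have key : ∀ (L : ℕ), Odd L → 1 < L → ∃ bB pB : ℝ, ∀ (b₀ p₀ : ℝ), bB ≤ b₀ → pB ≤ p₀ →
      ∃ γ₁ : ℝ, 0 < γ₁ ∧ ∀ (F : T3Family) (γ : ℝ), F.L = L → 0 < γ → γ ≤ γ₁ →
        HeightwiseUpperBound F γ ∧
        ∀ (n : ℕ), ∃ cl : ℝ, 0 < cl ∧ ∀ (K : ℕ) (hK : n ≤ K),
          ∀ᵐ V ∂(fieldMeasure (F.P n) 0 (Matrix.specialUnitaryGroup (Fin 2) ℂ)),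
            PlaqSmall (θBal F.L γ b₀ p₀ n) V →
              cl ≤ (partitionFn (G := Matrix.specialUnitaryGroup (Fin 2) ℂ) (F.P K) ((F.scheme ℰp γ).β K))⁻¹ *
                heightDensity F γ hK Set.univ V := by
    intro L hodd hL
    obtain ⟨B, a₀, a₁, b₁, p₁, hB, ha₀, ha₁, hBa, hprof⟩ := huni L hodd hL
    set M : ℝ := max B 1 with hM
    have hM1 : 1 ≤ M := le_max_right _ _
    have hMpos : 0 < M := lt_of_lt_of_le one_pos hM1
    refine ⟨max b₁ 0, p₁, fun b₀ p₀ hb hp => ?_⟩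
    have hb₀0 : 0 ≤ b₀ := (le_max_right _ _).trans hb
    have hb₁ : b₁ ≤ M * b₀ := by
      have h1 : b₁ ≤ b₀ := (le_max_left _ _).trans hb
      have h2 : b₀ ≤ M * b₀ := by nlinarith
      exact h1.trans h2
    obtain ⟨𝔠, h𝔠b, h𝔠p, h𝔠B, hOf⟩ := hprof (M * b₀) p₀ hb₁ hp
    obtain ⟨γθ, hγθ, hθ⟩ := exists_coupling_window_letters hL.le 𝔠.b₀ 𝔠.p₀ 𝔠.B₃_pos ha₀ ha₁
    refine ⟨min ((min 𝔠.gamma0 1) ^ 2) γθ, lt_min (pow_pos (lt_min 𝔠.gamma0_pos one_pos) 2) hγθ, fun F γ hFL hγ hγle => ?_⟩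
    subst hFL
    have hγ1 : γ ≤ (min 𝔠.gamma0 1) ^ 2 := hγle.trans (min_le_left _ _)
    obtain ⟨hθ₁, hθ₀⟩ := hθ γ hγ (hγle.trans (min_le_right _ _))
    have hc : 0 < a₀ ∧ 0 < a₁ ∧ 𝔠.B₃ * a₁ ≤ a₀ := ⟨ha₀, ha₁, by rw [h𝔠B]; exact hBa⟩
    have hq := quotientBounds_of_packageV4Chi (hOf F rfl) hc γ hγ hγ1 hθ₁ hθ₀
    -- the interior window of the scaled record is print's window at `(b₀, p₀)`
    have hMB : max 𝔠.B₃ 1 = M := by rw [h𝔠B]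
    have hwin : ∀ (n : ℕ) (V : GaugeField (F.P n) 0 (Matrix.specialUnitaryGroup (Fin 2) ℂ)),
        PlaqSmall (θBal F.L γ b₀ p₀ n) V → PlaqSmall (θBal F.L γ 𝔠.b₀ 𝔠.p₀ n / max 𝔠.B₃ 1) V := by
      intro n V hV
      rw [hMB, h𝔠b, h𝔠p]
      exact (plaqSmall_interior_of_profile_mul_iff F.L γ b₀ p₀ n hMpos.ne' V).2 hV
    refine ⟨fun n => ?_, fun n => ?_⟩
    · obtain ⟨C, c, -, hCc⟩ := hq n
      exact ⟨C, fun K hK => (hCc K hK).1⟩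
    · obtain ⟨C, c, hc0, hCc⟩ := hq n
      refine ⟨c, hc0, fun K hK => ?_⟩
      filter_upwards [(hCc K hK).2] with V hV hsmall
      exact hV (hwin n V hsmall)
  refine ⟨fun L => ?_, fun L => ?_⟩
  · by_cases hL : Odd L ∧ 1 < L
    · obtain ⟨bB, pB, hkey⟩ := key L hL.1 hL.2
      obtain ⟨γ₁, hγ₁, hF⟩ := hkey bB pB le_rfl le_rfl
      exact ⟨γ₁, hγ₁, fun F γ hFL hγ hγle => (hF F γ hFL hγ hγle).1⟩
    · exact ⟨1, one_pos, fun F γ hFL _ _ => absurd (hFL ▸ F.hL) hL⟩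
  · by_cases hL : Odd L ∧ 1 < L
    · obtain ⟨bB, pB, hkey⟩ := key L hL.1 hL.2
      refine ⟨bB, pB, fun b₀ p₀ hb hp => ?_⟩
      obtain ⟨γ₁, hγ₁, hF⟩ := hkey b₀ p₀ hb hp
      exact ⟨γ₁, hγ₁, fun F γ hFL hγ hγle => (hF F γ hFL hγ hγle).2⟩
    · exact ⟨0, 0, fun b₀ p₀ _ _ => ⟨1, one_pos, fun F γ hFL _ _ => absurd (hFL ▸ F.hL) hL⟩⟩

/-! ## §3 PERS₁∘ and TUBE∘ — texts verbatim — from UP∘ ∧ LOWB∘ as data, hence from the 19936 rows -/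

/-- ★★★★ **THE CONSUMERS' ⟨UP⟩ + ⟨LOW ON A SUB-PROFILE WINDOW⟩ BUNDLE FROM UP∘ ∧ LOWB∘ AS HYPOTHESES** (✓p768520 `upLow_of_v3Rec` with the socket abstracted to the pair of organ
rows): for a profile map `t` positive on positive arguments, in PERS₁∘'s prefix (`c₀ := 1`, `pS := pB`), `γ₁ := min γ₁ᵁ γ₁ᴸ(max (t c b₀) bB, p₀)`, and the organ's window
`{PlaqSmall θBal(t c b₀, p₀, J+1)}` lies INSIDE LOWB∘'s window at profile `max (t c b₀) bB` (`θBal` linear in `b₀`, lit ✓`θBal_mul`). [cite: Balaban1985UV3, (4)–(7) pp.256–257, (47) p.267] -/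
theorem upLow_of_stabilityCans (hUL : (∀ (L : ℕ), ∃ γ₁ : ℝ, 0 < γ₁ ∧ ∀ (F : T3Family) (γ : ℝ), F.L = L → 0 < γ → γ ≤ γ₁ → HeightwiseUpperBound F γ) ∧
    (∀ (L : ℕ), ∃ bB pB : ℝ, ∀ (b₀ p₀ : ℝ), bB ≤ b₀ → pB ≤ p₀ →
      ∃ γ₁ : ℝ, 0 < γ₁ ∧ ∀ (F : T3Family) (γ : ℝ), F.L = L → 0 < γ → γ ≤ γ₁ →
        ∀ (n : ℕ), ∃ cl : ℝ, 0 < cl ∧ ∀ (K : ℕ) (hK : n ≤ K),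
          ∀ᵐ V ∂(fieldMeasure (F.P n) 0 (Matrix.specialUnitaryGroup (Fin 2) ℂ)),
            PlaqSmall (θBal F.L γ b₀ p₀ n) V →
              cl ≤ (partitionFn (G := Matrix.specialUnitaryGroup (Fin 2) ℂ) (F.P K) ((F.scheme ℰp γ).β K))⁻¹ *
                heightDensity F γ hK Set.univ V)) (t : ℝ → ℝ → ℝ) (ht : ∀ c b₀ : ℝ, 0 < c → 0 < b₀ → 0 < t c b₀) :
    ∀ (L : ℕ), ∃ c₀ : ℝ, 0 < c₀ ∧ c₀ ≤ 1 ∧ ∀ (c : ℝ), 0 < c → c ≤ c₀ → ∃ pS : ℝ, ∀ (b₀ p₀ : ℝ), 0 < b₀ → pS ≤ p₀ → 0 < p₀ →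
      ∃ γ₁ : ℝ, 0 < γ₁ ∧ ∀ (F : T3Family) (γ : ℝ), F.L = L → 0 < γ → γ ≤ γ₁ →
        HeightwiseUpperBound F γ ∧
        ∀ (J : ℕ), ∃ cl : ℝ, 0 < cl ∧ ∀ (K : ℕ) (hJK : J + 1 ≤ K),
          ∀ᵐ V ∂(fieldMeasure (F.P (J + 1)) 0 (Matrix.specialUnitaryGroup (Fin 2) ℂ)), PlaqSmall (θBal F.L γ (t c b₀) p₀ (J + 1)) V →
            cl ≤ (partitionFn (G := Matrix.specialUnitaryGroup (Fin 2) ℂ) (F.P K) ((F.scheme ℰp γ).β K))⁻¹ * heightDensity F γ hJK Set.univ V := by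
  obtain ⟨hUP, hLOW⟩ := hUL
  intro L
  obtain ⟨γU, hγU, hU⟩ := hUP L
  obtain ⟨bB, pB, hBP⟩ := hLOW L
  refine ⟨1, one_pos, le_rfl, fun c hc _ => ⟨pB, fun b₀ p₀ hb₀ hpB hp₀ => ?_⟩⟩
  obtain ⟨γL, hγL, hLw⟩ := hBP (max (t c b₀) bB) p₀ (le_max_right _ _) hpB
  refine ⟨min γU γL, lt_min hγU hγL, fun F γ hFL hγ hγle => ?_⟩
  have hγU' : γ ≤ γU := hγle.trans (min_le_left _ _)
  have hγL' : γ ≤ γL := hγle.trans (min_le_right _ _)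
  refine ⟨hU F γ hFL hγ hγU', fun J => ?_⟩
  obtain ⟨cl, hcl, hK⟩ := hLw F γ hFL hγ hγL' (J + 1)
  refine ⟨cl, hcl, fun K hJK => ?_⟩
  have hmono : ∀ V : GaugeField (F.P (J + 1)) 0 (Matrix.specialUnitaryGroup (Fin 2) ℂ),
      PlaqSmall (θBal F.L γ (t c b₀) p₀ (J + 1)) V → PlaqSmall (θBal F.L γ (max (t c b₀) bB) p₀ (J + 1)) V := by
    intro V hV q
    refine lt_of_lt_of_le (hV q) ?_
    have htpos : 0 < t c b₀ := ht c b₀ hc hb₀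
    have hM : 0 < max (t c b₀) bB := lt_of_lt_of_le htpos (le_max_left _ _)
    have hlin : θBal F.L γ (t c b₀) p₀ (J + 1) = (t c b₀ / max (t c b₀) bB) * θBal F.L γ (max (t c b₀) bB) p₀ (J + 1) := by
      rw [← T3InteriorExcision.θBal_mul, div_mul_cancel₀ _ hM.ne']
    by_cases hnn : 0 ≤ θBal F.L γ (max (t c b₀) bB) p₀ (J + 1)
    · rw [hlin]
      exact mul_le_of_le_one_left hnn (div_le_one_of_le₀ (le_max_left _ _) hM.le)
    · exfalso
      have hq := hV q
      rw [hlin] at hq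
      have hdn : 0 ≤ GaugeGroup.dist1 (GaugeField.plaqHol V q) := GaugeGroup.dist1_nonneg _
      have : (t c b₀ / max (t c b₀) bB) * θBal F.L γ (max (t c b₀) bB) p₀ (J + 1) < 0 :=
        mul_neg_of_pos_of_neg (div_pos htpos hM) (lt_of_not_ge hnn)
      linarith
  filter_upwards [hK K hJK] with V hV hsmall
  exact hV (hmono V hsmall)

/-- ★★★★★ **PERS₁∘ (`OneLevelPersistenceIntCan`, text = LEAD g18 ✓p766163's conclusion VERBATIM) FROM THE 19936 REGISTRY v6 ROWS {EX = `hT8`, (O‴χₛ) = `hrows`} BY NAME** — the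
χ∕rows EDITION OF RECORD of the persistence row (★★OWNER RULING №44 (iii)): ✓`oneLevelPersistenceIntCan_of_heightwiseBounds` ∘ `upLow_of_stabilityCans` ∘ §2.
[cite: Balaban1985UV3, (4)–(7) pp.256–257, Thm 1 p.257, (41) p.266, (47) p.267; Balaban1985Variational, Thm 1 (8) p.279] -/
theorem oneLevelPersistenceIntCan_of_thm1In8_selXsDataRows
    (hT8 : ∀ L : ℕ, Odd L → 1 < L → ∃ a₀ a₁ B₃ : ℝ, 0 < a₀ ∧ 0 < a₁ ∧ 0 < B₃ ∧
      Thm1GlobalMinAt L a₀ a₁ B₃ ∧ MinimisersIn8At L a₀ a₁ B₃)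
    (hrows : ∀ L : ℕ, Odd L → 1 < L → ∃ (B₀ A₀ A₁ : ℝ), 0 < A₀ ∧ 0 < A₁ ∧
      ∀ (B a₀ a₁ : ℝ), B₀ ≤ B → 1 ≤ 2 * B → 0 < a₀ → a₀ ≤ A₀ → 0 < a₁ → a₁ ≤ A₁ → B * a₁ ≤ a₀ →
        (143 * ((((3 + 4 : ℕ) : ℝ)) ^ 2 / 4) ^ 2) * (2 * (B * a₁)) ≤ 1 / 3 →
        2 * (2 * (B * a₁)) ≤ 2 * deltaSU (Fin 2) / (((3 + 4) * L : ℕ) : ℝ) ^ 2 →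
        Thm1GlobalMinAt L a₀ a₁ B →
        ∃ (b₁ p₁ : ℝ), ∀ (b₀ p₀ : ℝ), b₁ ≤ b₀ → p₁ ≤ p₀ →
          ∃ 𝔠 : AlphaConsts L (suGroupModel 2).N, 𝔠.b₀ = b₀ ∧ 𝔠.p₀ = p₀ ∧ 𝔠.B₃ = B ∧
            4 * 𝔠.B₃ * (L : ℝ) ^ 2 * avgWindowFactor L ≤ 𝔠.C68 ∧
            Real.exp (𝔠.p₀ - 1) ≤ 3 * C0 3 * 𝔠.C68 * (𝔠.b₀ * Q0 𝔠.p₀) ∧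
            (𝔠.b₀ * Q0 𝔠.p₀) * (2 * (L : ℝ) ^ 2 * avgWindowFactor L) ^ 2 ≤ 3 * C0 3 * 𝔠.C68 * a₁ ^ 2 ∧
            ∀ (F : T3Family) (hF : F.L = L),
              (∀ (γ : ℝ) (hγ : 0 < γ) (hγ1 : γ ≤ (min (hF ▸ 𝔠).gamma0 1) ^ 2) (K : ℕ),
                AlphaInputsT3AC.SmallFactor71OfRecT3 F (hF ▸ 𝔠) γ hγ hγ1 K) ∧
              ∀ (γ : ℝ) (hγ : 0 < γ) (hγ1 : γ ≤ (min (hF ▸ 𝔠).gamma0 1) ^ 2) (K : ℕ),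
                (∃ Ut : (k : ℕ) → GaugeField (F.P K) k (Matrix.specialUnitaryGroup (Fin 2) ℂ) →
                    GaugeField (F.P K) 0 (Matrix.specialUnitaryGroup (Fin 2) ℂ),
                  AlphaInputsT3AC.TrivMinimiserRowsT3 F (hF ▸ 𝔠) γ hγ hγ1 a₀ a₁ K Ut) →
                ∃ Ut : (k : ℕ) → GaugeField (F.P K) k (Matrix.specialUnitaryGroup (Fin 2) ℂ) →
                    GaugeField (F.P K) 0 (Matrix.specialUnitaryGroup (Fin 2) ℂ),
                  AlphaInputsT3AC.TrivMinimiserRowsT3 F (hF ▸ 𝔠) γ hγ hγ1 a₀ a₁ K Ut ∧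
                    AlphaInputsT3AC.DataRowsT3XsChiSel F (hF ▸ 𝔠) γ hγ hγ1 K Ut) :
    ∀ (L : ℕ), ∃ c₀ : ℝ, 0 < c₀ ∧ c₀ ≤ 1 ∧ ∀ (c : ℝ), 0 < c → c ≤ c₀ → ∃ pS : ℝ, ∀ (b₀ p₀ : ℝ), 0 < b₀ → pS ≤ p₀ → 0 < p₀ →
      ∃ γ₁ : ℝ, 0 < γ₁ ∧ ∀ (F : T3Family) (γ : ℝ), F.L = L → 0 < γ → γ ≤ γ₁ →
        ∀ (J : ℕ), ∃ q : ℝ, 0 < q ∧ ∀ (K : ℕ) (hJK : J + 1 ≤ K)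
          (B : Set (GaugeField (F.P J) 0 (Matrix.specialUnitaryGroup (Fin 2) ℂ))), MeasurableSet B →
            B ⊆ {U | PlaqSmall (θBal F.L γ (c * b₀) p₀ J) U} →
            ENNReal.ofReal q * gibbsK F ℰp γ K (descendTo F ℰp J K ((Nat.le_succ J).trans hJK) ⁻¹' B) ≤
              gibbsK F ℰp γ K (descendTo F ℰp J K ((Nat.le_succ J).trans hJK) ⁻¹' B ∩
                descendTo F ℰp (J + 1) K hJK ⁻¹' {V | PlaqSmall (θBal F.L γ (c * b₀) p₀ (J + 1)) V}) :=
  FluctuationComparisonRegPrIntLPersistenceFromThm1.oneLevelPersistenceIntCan_of_heightwiseBounds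
    (upLow_of_stabilityCans (stabilityCans_of_thm1In8_selXsDataRows hT8 hrows) (fun c b₀ => c * b₀) fun _ _ hc hb₀ => mul_pos hc hb₀)

/-- ★★★★★ **TUBE∘ (`SectionTubeMassIntCan`, text = w4-20520 ✓p766221's conclusion VERBATIM) FROM THE 19936 REGISTRY v6 ROWS BY NAME** — the χ∕rows EDITION OF RECORD of the tube row:
✓`sectionTubeMassIntCan_of_heightwiseBounds` ∘ `upLow_of_stabilityCans` (`t c b₀ := 2·b₀`, `2·θBal(b₀) = θBal(2b₀)`) ∘ §2.
[cite: Balaban1985UV3, (4)–(7) pp.256–257, Thm 1 p.257, (41) p.266, (47) p.267; Balaban1985Averaging, (10) p.19] -/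
theorem sectionTubeMassIntCan_of_thm1In8_selXsDataRows
    (hT8 : ∀ L : ℕ, Odd L → 1 < L → ∃ a₀ a₁ B₃ : ℝ, 0 < a₀ ∧ 0 < a₁ ∧ 0 < B₃ ∧
      Thm1GlobalMinAt L a₀ a₁ B₃ ∧ MinimisersIn8At L a₀ a₁ B₃)
    (hrows : ∀ L : ℕ, Odd L → 1 < L → ∃ (B₀ A₀ A₁ : ℝ), 0 < A₀ ∧ 0 < A₁ ∧
      ∀ (B a₀ a₁ : ℝ), B₀ ≤ B → 1 ≤ 2 * B → 0 < a₀ → a₀ ≤ A₀ → 0 < a₁ → a₁ ≤ A₁ → B * a₁ ≤ a₀ →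
        (143 * ((((3 + 4 : ℕ) : ℝ)) ^ 2 / 4) ^ 2) * (2 * (B * a₁)) ≤ 1 / 3 →
        2 * (2 * (B * a₁)) ≤ 2 * deltaSU (Fin 2) / (((3 + 4) * L : ℕ) : ℝ) ^ 2 →
        Thm1GlobalMinAt L a₀ a₁ B →
        ∃ (b₁ p₁ : ℝ), ∀ (b₀ p₀ : ℝ), b₁ ≤ b₀ → p₁ ≤ p₀ →
          ∃ 𝔠 : AlphaConsts L (suGroupModel 2).N, 𝔠.b₀ = b₀ ∧ 𝔠.p₀ = p₀ ∧ 𝔠.B₃ = B ∧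
            4 * 𝔠.B₃ * (L : ℝ) ^ 2 * avgWindowFactor L ≤ 𝔠.C68 ∧
            Real.exp (𝔠.p₀ - 1) ≤ 3 * C0 3 * 𝔠.C68 * (𝔠.b₀ * Q0 𝔠.p₀) ∧
            (𝔠.b₀ * Q0 𝔠.p₀) * (2 * (L : ℝ) ^ 2 * avgWindowFactor L) ^ 2 ≤ 3 * C0 3 * 𝔠.C68 * a₁ ^ 2 ∧
            ∀ (F : T3Family) (hF : F.L = L),
              (∀ (γ : ℝ) (hγ : 0 < γ) (hγ1 : γ ≤ (min (hF ▸ 𝔠).gamma0 1) ^ 2) (K : ℕ),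
                AlphaInputsT3AC.SmallFactor71OfRecT3 F (hF ▸ 𝔠) γ hγ hγ1 K) ∧
              ∀ (γ : ℝ) (hγ : 0 < γ) (hγ1 : γ ≤ (min (hF ▸ 𝔠).gamma0 1) ^ 2) (K : ℕ),
                (∃ Ut : (k : ℕ) → GaugeField (F.P K) k (Matrix.specialUnitaryGroup (Fin 2) ℂ) →
                    GaugeField (F.P K) 0 (Matrix.specialUnitaryGroup (Fin 2) ℂ),
                  AlphaInputsT3AC.TrivMinimiserRowsT3 F (hF ▸ 𝔠) γ hγ hγ1 a₀ a₁ K Ut) →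
                ∃ Ut : (k : ℕ) → GaugeField (F.P K) k (Matrix.specialUnitaryGroup (Fin 2) ℂ) →
                    GaugeField (F.P K) 0 (Matrix.specialUnitaryGroup (Fin 2) ℂ),
                  AlphaInputsT3AC.TrivMinimiserRowsT3 F (hF ▸ 𝔠) γ hγ hγ1 a₀ a₁ K Ut ∧
                    AlphaInputsT3AC.DataRowsT3XsChiSel F (hF ▸ 𝔠) γ hγ hγ1 K Ut) :
    ∀ (L : ℕ), ∃ c₀ : ℝ, 0 < c₀ ∧ c₀ ≤ 1 ∧ ∀ (c : ℝ), 0 < c → c ≤ c₀ → ∃ pS : ℝ, ∀ (b₀ p₀ : ℝ), 0 < b₀ → pS ≤ p₀ → 0 < p₀ →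
      ∃ γ₁ : ℝ, 0 < γ₁ ∧ ∀ (F : T3Family) (γ : ℝ), F.L = L → 0 < γ → γ ≤ γ₁ →
        ∀ (J : ℕ) (r : ℝ), 0 < r →
          ∀ σ : GaugeField (F.P J) 0 (Matrix.specialUnitaryGroup (Fin 2) ℂ) → GaugeField (F.P (J + 1)) 0 (Matrix.specialUnitaryGroup (Fin 2) ℂ), Measurable σ →
            (∀ U : GaugeField (F.P J) 0 (Matrix.specialUnitaryGroup (Fin 2) ℂ), PlaqSmall (θBal F.L γ (c * b₀) p₀ J) U →
              descendTo F ℰp J (J + 1) (Nat.le_succ J) (σ U) = U ∧ PlaqSmall (θBal F.L γ b₀ p₀ (J + 1)) (σ U)) →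
            ∃ q : ℝ, 0 < q ∧ ∀ (K : ℕ) (hJK : J + 1 ≤ K)
              (B : Set (GaugeField (F.P J) 0 (Matrix.specialUnitaryGroup (Fin 2) ℂ))), MeasurableSet B →
                B ⊆ {U | PlaqSmall (θBal F.L γ (c * b₀) p₀ J) U} →
                ENNReal.ofReal q * gibbsK F ℰp γ K (descendTo F ℰp J K ((Nat.le_succ J).trans hJK) ⁻¹' B) ≤
                  gibbsK F ℰp γ K (descendTo F ℰp J K ((Nat.le_succ J).trans hJK) ⁻¹' B ∩
                    {V | ∀ b : PBond (F.P (J + 1)) 0,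
                      dist1 ((σ (descendTo F ℰp J K ((Nat.le_succ J).trans hJK) V) b)⁻¹ *
                        descendTo F ℰp (J + 1) K hJK V b) < r}) := by
  have h := upLow_of_stabilityCans (stabilityCans_of_thm1In8_selXsDataRows hT8 hrows) (fun _ b₀ => 2 * b₀) fun _ _ _ hb₀ => by positivity
  refine FluctuationComparisonRegPrIntLTubeFromThm1.sectionTubeMassIntCan_of_heightwiseBounds fun L => ?_
  obtain ⟨c₀, hc₀, hc₀1, hc⟩ := h L
  refine ⟨c₀, hc₀, hc₀1, fun c hcpos hcle => ?_⟩
  obtain ⟨pS, hpS⟩ := hc c hcpos hcle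
  refine ⟨pS, fun b₀ p₀ hb₀ hpS' hp₀ => ?_⟩
  obtain ⟨γ₁, hγ₁, hF⟩ := hpS b₀ p₀ hb₀ hpS' hp₀
  refine ⟨γ₁, hγ₁, fun F γ hFL hγ hγle => ?_⟩
  obtain ⟨hup, hlow⟩ := hF F γ hFL hγ hγle
  refine ⟨hup, fun J => ?_⟩
  obtain ⟨cl, hcl, hK⟩ := hlow J
  refine ⟨cl, hcl, fun K hJK => ?_⟩
  filter_upwards [hK K hJK] with V hV hsmall
  refine hV ?_
  rw [T3InteriorExcision.θBal_mul]
  exact hsmall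


end Summit.QuantumFields.YangMills.Theorems.FluctuationComparisonRegPrIntLPersistenceOfRowsV4Chi

end
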